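import Mathlib.RingTheory.AlgebraTower
import Mathlib.LinearAlgebra.Basis.Basic
import Literature.NumberTheory.GaloisCohomology.FrobeniusDeRham
import HarnessLib

/-!
# Bases of a Frobenius twist: products of a basis of the twisted ring with a basis of the module

Let `R` be a commutative ring of exponential characteristic `p` and `M` an `R`-module.  The Frobenius twist
`FrobeniusTwist p R M` (`FrobeniusDeRham.lean`) is `M` with the scalar action `c • m := c ^ p • m`; in
particular `FrobeniusTwist p R R` is `R` as a module over itself THROUGH FROBENIUS, and an `R`-basis
`b : κ₁ → FrobeniusTwist p R R` of it is the datum "`R` is free over `R^p`" (e.g. the `p`-monomials of a finite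
`p`-basis, `PBasis.lean`).  Writing `u a : R` for the ring element underlying `b a`, every `r : R` is uniquely
`r = ∑ a, (c a) ^ p * u a`.

Given moreover an ordinary `R`-basis `e : κ₂ → M` of `M`, the products `u a • e k` form an `R`-basis of the
twist `FrobeniusTwist p R M`: `x = ∑ k, r k • e k = ∑ (a, k), (c a k) ^ p • (u a • e k)`.  This is the basis
`FrobeniusTwist.basisProd p b e : Module.Basis (κ₁ × κ₂) R (FrobeniusTwist p R M)` constructed here, with

* `basisProd_apply : basisProd p b e (a, k) = of (u a • e k)`;
* `basisProd_repr_apply : (basisProd p b e).repr x (a, k) = b.repr (of (e.repr (of.symm x) k)) a`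
  (expand `x` in `e`, then expand each coefficient in `b`).

It is the special case of Mathlib's tower basis `Module.Basis.smulTower` for the "tower"
`R → FrobeniusTwist p R R ↷ FrobeniusTwist p R M`, where the middle term carries the ring structure of `R` and
acts on `FrobeniusTwist p R M = M` by the ORIGINAL action.  These auxiliary structures
(`FrobeniusTwist.commRing`, `FrobeniusTwist.moduleOrig`, `FrobeniusTwist.isScalarTower_orig`, and the
re-based basis `FrobeniusTwist.basisOrig`) are definitions used as LOCAL instances in this file only; importing
the file does not register any instance.  A consumer who wants them writes
`attribute [local instance] FrobeniusTwist.commRing FrobeniusTwist.moduleOrig FrobeniusTwist.isScalarTower_orig`.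

Used by the Cartier-isomorphism programme (decomposition of the de Rham complex of a ring with a finite
`p`-basis).

## References

* H. Matsumura, *Commutative Ring Theory*, CUP 1986, §26 (`p`-bases). [Matsumura1987]
* L. Illusie, *Complexe de de Rham–Witt et cohomologie cristalline*, Ann. Sci. ÉNS 12 (1979), 0.2.1. [Illusie1979]
-/

noncomputable section

namespace Literature.NumberTheory.GaloisCohomology

universe u v

namespace FrobeniusTwist

variable (p : ℕ) {R : Type u} [CommRing R]

/-! ### The ring structure on the twist of the ring itself (local instances) -/

/-- The commutative ring structure of `R` transported to the Frobenius twist `FrobeniusTwist p R R` (whose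
underlying additive group is that of `R`).  A definition, used as a LOCAL instance only. [folklore] -/
local instance commRing : CommRing (FrobeniusTwist p R R) := inferInstanceAs (CommRing R)

/-- Multiplication in `FrobeniusTwist p R R` is that of `R`. [folklore] -/
theorem of_symm_mul (s t : FrobeniusTwist p R R) : (of p R).symm (s * t) = (of p R).symm s * (of p R).symm t :=
  rfl

/-- Multiplication in `FrobeniusTwist p R R` is that of `R`. [folklore] -/
theorem of_mul (s t : R) : of p R (s * t) = of p R s * of p R t :=
  rfl

/-- The unit of `FrobeniusTwist p R R` is that of `R`. [folklore] -/
theorem of_one : of p R (1 : R) = 1 :=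
  rfl

variable {M : Type v} [AddCommGroup M] [Module R M] {κ₁ : Type*} {κ₂ : Type*}

/-- The ring `FrobeniusTwist p R R` (a copy of `R`) acts on the twist `FrobeniusTwist p R M` (a copy of `M`)
through the ORIGINAL action of `R` on `M`.  A definition, used as a LOCAL instance only. [folklore] -/
local instance moduleOrig : Module (FrobeniusTwist p R R) (FrobeniusTwist p R M) := inferInstanceAs (Module R M)

/-- The action of `FrobeniusTwist p R R` on `FrobeniusTwist p R M` is the original action of `R` on `M`.
[folklore] -/
theorem orig_smul_def (s : FrobeniusTwist p R R) (x : FrobeniusTwist p R M) :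
    s • x = of p R ((of p R).symm s • (of p R).symm x) :=
  rfl

/-- An `R`-basis `e` of `M`, viewed as a basis of `FrobeniusTwist p R M` over the ring `FrobeniusTwist p R R`
(same vectors, same coordinates). [folklore] -/
def basisOrig (e : Module.Basis κ₂ R M) : Module.Basis κ₂ (FrobeniusTwist p R R) (FrobeniusTwist p R M) :=
  .ofRepr e.repr

/-- The vectors of `basisOrig p e` are those of `e`. [folklore] -/
@[simp] theorem basisOrig_apply (e : Module.Basis κ₂ R M) (k : κ₂) : basisOrig p e k = of p R (e k) :=
  rfl

/-- The coordinates of `basisOrig p e` are those of `e`. [folklore] -/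
@[simp] theorem basisOrig_repr_apply (e : Module.Basis κ₂ R M) (x : FrobeniusTwist p R M) (k : κ₂) :
    (basisOrig p e).repr x k = of p R (e.repr ((of p R).symm x) k) :=
  rfl

variable [ExpChar R p]

/-- The tower `R → FrobeniusTwist p R R ↷ FrobeniusTwist p R M`: `(c ^ p * s) • m = c ^ p • (s • m)`.
A LOCAL instance only. [folklore] -/
local instance isScalarTower_orig : IsScalarTower R (FrobeniusTwist p R R) (FrobeniusTwist p R M) :=
  ⟨fun c s m => mul_smul ((frobenius R p) c) ((of p R).symm s) ((of p R).symm m)⟩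

/-! ### The product basis -/

/-- **The product basis of a Frobenius twist.**  From an `R`-basis `b` of `FrobeniusTwist p R R` (i.e. of `R`
over itself acting through Frobenius — e.g. the `p`-monomials of a `p`-basis) and an `R`-basis `e` of `M`, the
`R`-basis of `FrobeniusTwist p R M` indexed by `κ₁ × κ₂` whose `(a, k)`-th vector is `u a • e k`, `u a : R` the
ring element underlying `b a`: every `x : M` is uniquely `∑ (a, k), (c a k) ^ p • (u a • e k)`.  (Mathlib's
`Module.Basis.smulTower` for the tower `R → FrobeniusTwist p R R ↷ FrobeniusTwist p R M`.) [folklore] -/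
def basisProd (b : Module.Basis κ₁ R (FrobeniusTwist p R R)) (e : Module.Basis κ₂ R M) :
    Module.Basis (κ₁ × κ₂) R (FrobeniusTwist p R M) :=
  b.smulTower (basisOrig p e)

/-- The `(a, k)`-th vector of the product basis is `u a • e k`, `u a = of.symm (b a)` the ring element
underlying `b a`. [folklore] -/
@[simp] theorem basisProd_apply (b : Module.Basis κ₁ R (FrobeniusTwist p R R)) (e : Module.Basis κ₂ R M)
    (a : κ₁) (k : κ₂) : basisProd p b e (a, k) = of p R ((of p R).symm (b a) • e k) := by
  rw [basisProd, Module.Basis.smulTower_apply]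
  rfl

/-- The vectors of the product basis, unpaired-index form: `basisProd p b e ij = u ij.1 • e ij.2`. [folklore] -/
theorem basisProd_apply' (b : Module.Basis κ₁ R (FrobeniusTwist p R R)) (e : Module.Basis κ₂ R M)
    (ij : κ₁ × κ₂) : basisProd p b e ij = of p R ((of p R).symm (b ij.1) • e ij.2) :=
  basisProd_apply p b e ij.1 ij.2

/-- The underlying element of `M` of the `(a, k)`-th vector of the product basis is `u a • e k`. [folklore] -/
theorem of_symm_basisProd_apply (b : Module.Basis κ₁ R (FrobeniusTwist p R R)) (e : Module.Basis κ₂ R M)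
    (a : κ₁) (k : κ₂) : (of p R).symm (basisProd p b e (a, k)) = (of p R).symm (b a) • e k := by
  rw [basisProd_apply]
  rfl

/-- **Coordinates in the product basis**: the `(a, k)`-th coordinate of `x` is the `a`-th `b`-coordinate of
the `k`-th `e`-coordinate of `x` — expand `x = ∑ k, r k • e k` in `e`, then each `r k = ∑ a, (c a k) ^ p * u a`
in `b`. [folklore] -/
theorem basisProd_repr_apply (b : Module.Basis κ₁ R (FrobeniusTwist p R R)) (e : Module.Basis κ₂ R M)
    (x : FrobeniusTwist p R M) (a : κ₁) (k : κ₂) :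
    (basisProd p b e).repr x (a, k) = b.repr (of p R (e.repr ((of p R).symm x) k)) a := by
  rw [basisProd, Module.Basis.smulTower_repr_mk]
  rfl

/-- Coordinates in the product basis, unpaired-index form. [folklore] -/
theorem basisProd_repr_apply' (b : Module.Basis κ₁ R (FrobeniusTwist p R R)) (e : Module.Basis κ₂ R M)
    (x : FrobeniusTwist p R M) (ij : κ₁ × κ₂) :
    (basisProd p b e).repr x ij = b.repr (of p R (e.repr ((of p R).symm x) ij.2)) ij.1 :=
  basisProd_repr_apply p b e x ij.1 ij.2

end FrobeniusTwist

end Literature.NumberTheory.GaloisCohomology
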